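/-
Copyright (c) 2026 the pub-hodgecm-mathlib formalisation cell (harness21).  Prover seat hodgecm-mathlib-K2Liu-p13 (g0), Track B «K2-LIT»,
#184♮ = hLiu418 = `stmt-HodgeConjecture-24832`; #42S payer road, organ S3, file S3-F4′ (LEAD F0P6-plan (g13): «type the local factors as members of `localDegPS`»).
-/
import Summits.HodgeConjecture.HodgeConjecture.Theorems.K2LiuKFiniteSectionMultiPlaceDecomposition   -- ★ S3-F4
import Literature.NumberTheory.K2Lit.LocalDoublingSiegel                                             -- ★ D7a: `localDegPS` read for the doubled datum, the two bridges
import HarnessLib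

/-!
# Crux `HLiu418`, #42S payer road, organ S3, file S3-F4′: THE LOCAL FACTORS OF THE SIMULTANEOUS-PURITY DECOMPOSITION ARE MEMBERS OF `I_v(s, χ_v)^{U_v}`

Cell `hodgecm-mathlib`, crux item hLiu418 = `stmt-HodgeConjecture-24832`; squad K2 ∕ K2Liu; LEAD F0P6-plan (g13), co-dealer K2E5-plan (g7); prover K2Liu-p13 (g0).
THEOREMS ONLY; lane `--supports stmt-HodgeConjecture-24832 --as helper` (count-neutral).

* §1 `isSmooth_of_level`, `isLocalSiegelSection_of_siegel`, `mem_localDegPS_of_siegel_of_level`: a function `b : H_v → ℂ` with the Siegel law for ★ `siegelCharLoc χ v s` on ★ `siegelDeltaLoc v` and right-invariant under an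
  OPEN `U_v ≤ H_v` lies in the K2Lit degenerate principal series ★ `localDegPS … v n … (fun w => χ.localComponent w.1) s` (bridges ★ `mem_siegelDeltaLoc_iff_local`,
  ★ `siegelCharLoc_eq_localSiegelCharacter_of_mem`; smoothness = the open level as an `OpenSubgroup`).
* §2 **`exists_sum_pure_on_finset_degPS`** = ★ S3-F4 `exists_sum_pure_on_finset_of_isStandardSectionFamily` with the local factors typed `b i v ∈ I_v(s, χ_v)` (★ `localDegPS`)
  and of level `ι_v⁻¹(U)` — the currency of organs S1∕S2 (`R_n(V_v^±) ≤ I_v(½, χ_v)`) and of (S4-glob).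
The K2Lit instance `Algebra.IsQuadraticExtension L⁺ L` is taken as an instance ARGUMENT (callers: `haveI := IsCMField.isQuadraticExtension L`).
No new literature: [HarrisKudlaSweet1996 §1 (1.15)–(1.16)], [Tan1999 §1], [BorelJacquet1979 §4.1], [Flath1979 §2].
HONEST LABEL.  Count-neutral helper: `HC_CM` is proved only modulo the 7 printed citations (2 remaining named inputs: hLiu418 = `stmt-HodgeConjecture-24832`,
h413 = `stmt-HodgeConjecture-24833`) until rung 0 closes.
-/

set_option autoImplicit false
set_option linter.dupNamespace false -- the mandated namespace repeats `HodgeConjecture.HodgeConjecture`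

noncomputable section

open NumberField IsDedekindDomain
open scoped Matrix

namespace Summit.HodgeConjecture.HodgeConjecture.Cruxes.HLiu418.K2LiuKFiniteSectionMultiPlaceDegPS

open Literature.NumberTheory.Automorphic hiding IsKFinite
open Literature.NumberTheory.GaloisRepresentations
open Literature.NumberTheory.GelbartRogawski1991 Literature.NumberTheory.GelbartRogawski1991.GRConstruction
open Literature.NumberTheory.GelbartRogawski1991.UnitaryDualPair
open Literature.NumberTheory.GelbartRogawski1991.UnitaryDualPair.LocalSplitting
open Literature.NumberTheory.K2Lit.SiegelDoubled
open Literature.NumberTheory.K2Lit.LocalSiegelDoubled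
open Summit.HodgeConjecture.HodgeConjecture.Cruxes.HLiu418.K2LiuKFiniteSectionMultiPlaceDecomposition (exists_sum_pure_on_finset_of_isStandardSectionFamily)

variable {L : Type} [Field L] [NumberField L] [IsCMField L]
variable {N M n : ℕ} {e : Fin N × Fin M ≃ Fin n}
  {dV : Fin N → L} {hdV : ∀ i, IsCMField.complexConj L (dV i) = dV i}
  {dW : Fin M → L} {hdW : ∀ i, IsCMField.complexConj L (dW i) = dW i}

/-! ## §1 Siegel law + open level ⇒ member of `I_v(s, χ_v)` -/

/-- **open level ⇒ smooth**: a function right-invariant under an OPEN `U_v ≤ H_v` is smooth in the K2Lit sense (`U_v` as an `OpenSubgroup`).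
[cite: HarrisKudlaSweet1996, §1 (1.15)] -/
theorem isSmooth_of_level (v : HeightOneSpectrum (𝓞 (Fp L))) {Uv : Subgroup (UnitaryGroup.localPi L (IsCMField.complexConj L) (n + n) (hermD L e dV hdV dW hdW) v)} (hUvo : IsOpen (Uv : Set (UnitaryGroup.localPi L (IsCMField.complexConj L) (n + n) (hermD L e dV hdV dW hdW) v))) {b : UnitaryGroup.localPi L (IsCMField.complexConj L) (n + n) (hermD L e dV hdV dW hdW) v → ℂ}
    (hl : ∀ u : UnitaryGroup.localPi L (IsCMField.complexConj L) (n + n) (hermD L e dV hdV dW hdW) v, ∀ u' ∈ Uv, b (u * u') = b u) :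
    IsSmooth (Fp L) L (IsCMField.complexConj L) v n b :=
  ⟨⟨Uv, hUvo⟩, fun h u hu => hl h u hu⟩

/-- **the Siegel law for `siegelCharLoc` on `siegelDeltaLoc` IS the K2Lit local Siegel law** for the character family `(χ_w)_{w∣v}` (★ bridges
`mem_siegelDeltaLoc_iff_local`, `siegelCharLoc_eq_localSiegelCharacter_of_mem`). [cite: HarrisKudlaSweet1996, §1 (1.15)] [cite: Tan1999, §1 p. 166] -/
theorem isLocalSiegelSection_of_siegel [Algebra.IsQuadraticExtension (Fp L) L] (v : HeightOneSpectrum (𝓞 (Fp L))) (χ : HeckeCharacter L) (s : ℂ) {b : UnitaryGroup.localPi L (IsCMField.complexConj L) (n + n) (hermD L e dV hdV dW hdW) v → ℂ}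
    (hσ : ∀ p ∈ siegelDeltaLoc L e dV hdV dW hdW v, ∀ u : UnitaryGroup.localPi L (IsCMField.complexConj L) (n + n) (hermD L e dV hdV dW hdW) v, b (p * u) = siegelCharLoc L e dV hdV dW hdW v χ s p * b u) :
    IsLocalSiegelSection (Fp L) L (IsCMField.complexConj L) (complexConj_imagUnit L) (imagUnit_ne_zero L) (imagUnit_mul_self L)
      v n (gramR_isSymm L e dV hdV dW hdW) (hermD_eq_map_gramD L e dV hdV dW hdW) (fun w => χ.localComponent w.1) s b := by
  intro p hp h
  have hp' : p ∈ siegelDeltaLoc L e dV hdV dW hdW v := (mem_siegelDeltaLoc_iff_local L e dV hdV dW hdW v p).2 hp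
  rw [← siegelCharLoc_eq_localSiegelCharacter_of_mem L e dV hdV dW hdW v χ s hp']
  exact hσ p hp' h

/-- **a level-`U_v` local Siegel section lies in `I_v(s, χ_v)`**: if `b (p u) = siegelCharLoc χ v s p · b u` for `p ∈ P_Δ(L⁺_v)` and `b` is right-invariant under
an open `U_v ≤ H_v`, then `b ∈ localDegPS … (χ_w)_{w∣v} s`. [cite: HarrisKudlaSweet1996, §1 (1.15)] [cite: Tan1999, §1 p. 166] -/
theorem mem_localDegPS_of_siegel_of_level [Algebra.IsQuadraticExtension (Fp L) L] (v : HeightOneSpectrum (𝓞 (Fp L))) {Uv : Subgroup (UnitaryGroup.localPi L (IsCMField.complexConj L) (n + n) (hermD L e dV hdV dW hdW) v)} (hUvo : IsOpen (Uv : Set (UnitaryGroup.localPi L (IsCMField.complexConj L) (n + n) (hermD L e dV hdV dW hdW) v)))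
    (χ : HeckeCharacter L) (s : ℂ) {b : UnitaryGroup.localPi L (IsCMField.complexConj L) (n + n) (hermD L e dV hdV dW hdW) v → ℂ} (hσ : ∀ p ∈ siegelDeltaLoc L e dV hdV dW hdW v, ∀ u : UnitaryGroup.localPi L (IsCMField.complexConj L) (n + n) (hermD L e dV hdV dW hdW) v, b (p * u) = siegelCharLoc L e dV hdV dW hdW v χ s p * b u)
    (hl : ∀ u : UnitaryGroup.localPi L (IsCMField.complexConj L) (n + n) (hermD L e dV hdV dW hdW) v, ∀ u' ∈ Uv, b (u * u') = b u) :
    b ∈ localDegPS (Fp L) L (IsCMField.complexConj L) (complexConj_imagUnit L) (imagUnit_ne_zero L) (imagUnit_mul_self L)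
      v n (gramR_isSymm L e dV hdV dW hdW) (hermD_eq_map_gramD L e dV hdV dW hdW) (fun w => χ.localComponent w.1) s := by
  rw [mem_localDegPS_iff]
  exact ⟨isLocalSiegelSection_of_siegel v χ s hσ, isSmooth_of_level v hUvo hl⟩

/-! ## §2 The simultaneous-purity binder with `b i v ∈ I_v(s, χ_v)` -/

set_option maxHeartbeats 800000 in -- measured > 200 000: the statement repeats the ★ S3-F4 binder (~30 `H(𝔸)`-component maps `evalPlace v (finPart h)`, expensive `H(𝔸)`-vs-`(adelicGroupData …).Adelic` unifications, cf. ★ S3-F3∕S3-F4); proof is `obtain`/`exact` only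
/-- **SIMULTANEOUS PURITY WITH LOCAL FACTORS IN `I_v(s, χ_v)`** (★ S3-F4 re-typed): for a standard Iwasawa datum `𝒦`, a `𝒦`-standard family `f` with `f s` continuous,
`s ∈ ℂ` and a finite set `T` of finite places: an open level `U ≤ H(𝔸_f)` of `f s`, `m`, local factors `b i v ∈ localDegPS … (χ_w)_{w∣v} s` right-invariant under
`ι_v⁻¹(U)` (`v ∈ T`), away-factors `a i` (Siegel on the `T`-trivial part of `P_Δ(𝔸)`, right-invariant under the `T`-trivial part of `(1,U)` and under `ι_v(H_v)`,
`v ∈ T`), and `f s h = Σᵢ a i h · ∏_{v∈T} b i v (h_v)`. [cite: HarrisKudlaSweet1996, §1 (1.15)–(1.16)] [cite: BorelJacquet1979, §4.1] [cite: Flath1979, §2] [cite: Tan1999, §1 p. 166] -/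
theorem exists_sum_pure_on_finset_degPS [Algebra.IsQuadraticExtension (Fp L) L] {𝒦 : IwasawaDatum L e dV hdV dW hdW} (h𝒦 : 𝒦.IsStd)
    {χ : HeckeCharacter L} {f : ℂ → HA L e dV hdV dW hdW → ℂ} (hf : IsStandardSectionFamily 𝒦 χ f) (hfc : ∀ s, Continuous (f s)) (s : ℂ) (T : Finset (HeightOneSpectrum (𝓞 (Fp L)))) :
    ∃ (Uf : Subgroup (UnitaryGroup.finAdelic (Fp L) L (IsCMField.complexConj L) (n + n) (hermD L e dV hdV dW hdW))) (m : ℕ) (b : Fin m → (v : HeightOneSpectrum (𝓞 (Fp L))) → (UnitaryGroup.localPi L (IsCMField.complexConj L) (n + n) (hermD L e dV hdV dW hdW) v → ℂ)) (a : Fin m → HA L e dV hdV dW hdW → ℂ),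
      IsOpen (Uf : Set (UnitaryGroup.finAdelic (Fp L) L (IsCMField.complexConj L) (n + n) (hermD L e dV hdV dW hdW))) ∧
      (∀ k : HA L e dV hdV dW hdW, UnitaryGroup.archPart (Fp L) L (IsCMField.complexConj L) (n + n) (hermD L e dV hdV dW hdW) k = 1 → UnitaryGroup.finPart (Fp L) L (IsCMField.complexConj L) (n + n) (hermD L e dV hdV dW hdW) k ∈ Uf → ∀ h : HA L e dV hdV dW hdW, f s (h * k) = f s h) ∧
      (∀ i, ∀ v ∈ T, b i v ∈ localDegPS (Fp L) L (IsCMField.complexConj L) (complexConj_imagUnit L) (imagUnit_ne_zero L) (imagUnit_mul_self L)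
          v n (gramR_isSymm L e dV hdV dW hdW) (hermD_eq_map_gramD L e dV hdV dW hdW) (fun w => χ.localComponent w.1) s ∧
        ∀ u : UnitaryGroup.localPi L (IsCMField.complexConj L) (n + n) (hermD L e dV hdV dW hdW) v, ∀ u' ∈ Uf.comap (UnitaryGroup.inclPlace (Fp L) L (IsCMField.complexConj L) (n + n) (hermD L e dV hdV dW hdW) v), b i v (u * u') = b i v u) ∧
      (∀ i, (∀ p : HA L e dV hdV dW hdW, IsSiegelDelta L e dV hdV dW hdW p → (∀ v ∈ T, UnitaryGroup.evalPlace (Fp L) L (IsCMField.complexConj L) (n + n) (hermD L e dV hdV dW hdW) v (UnitaryGroup.finPart (Fp L) L (IsCMField.complexConj L) (n + n) (hermD L e dV hdV dW hdW) p) = 1) → ∀ h : HA L e dV hdV dW hdW, a i (p * h) = siegelDeltaCharacter L e dV hdV dW hdW χ s p * a i h) ∧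
        (∀ k : HA L e dV hdV dW hdW, UnitaryGroup.archPart (Fp L) L (IsCMField.complexConj L) (n + n) (hermD L e dV hdV dW hdW) k = 1 → UnitaryGroup.finPart (Fp L) L (IsCMField.complexConj L) (n + n) (hermD L e dV hdV dW hdW) k ∈ Uf → (∀ v ∈ T, UnitaryGroup.evalPlace (Fp L) L (IsCMField.complexConj L) (n + n) (hermD L e dV hdV dW hdW) v (UnitaryGroup.finPart (Fp L) L (IsCMField.complexConj L) (n + n) (hermD L e dV hdV dW hdW) k) = 1) → ∀ h : HA L e dV hdV dW hdW, a i (h * k) = a i h) ∧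
        ∀ v ∈ T, ∀ (h : HA L e dV hdV dW hdW) (u : UnitaryGroup.localPi L (IsCMField.complexConj L) (n + n) (hermD L e dV hdV dW hdW) v), a i (h * locToAdelic L e dV hdV dW hdW v u) = a i h) ∧
      ∀ h : HA L e dV hdV dW hdW, f s h = ∑ i, a i h * ∏ v ∈ T, b i v (UnitaryGroup.evalPlace (Fp L) L (IsCMField.complexConj L) (n + n) (hermD L e dV hdV dW hdW) v (UnitaryGroup.finPart (Fp L) L (IsCMField.complexConj L) (n + n) (hermD L e dV hdV dW hdW) h)) := by
  obtain ⟨Uf, m, b, a, hUo, hU, hb, ha, hsum⟩ := exists_sum_pure_on_finset_of_isStandardSectionFamily h𝒦 hf hfc s T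
  have hUvo : ∀ v : HeightOneSpectrum (𝓞 (Fp L)), IsOpen ((Uf.comap (UnitaryGroup.inclPlace (Fp L) L (IsCMField.complexConj L) (n + n) (hermD L e dV hdV dW hdW) v)) : Set (UnitaryGroup.localPi L (IsCMField.complexConj L) (n + n) (hermD L e dV hdV dW hdW) v)) := fun v => by
    rw [Subgroup.coe_comap]
    exact hUo.preimage (UnitaryGroup.continuous_inclPlace (Fp L) L (IsCMField.complexConj L) (n + n) (hermD L e dV hdV dW hdW) v)
  exact ⟨Uf, m, b, a, hUo, hU, fun i v hv => ⟨mem_localDegPS_of_siegel_of_level v (hUvo v) χ s (hb i v hv).1 (hb i v hv).2, (hb i v hv).2⟩, ha, hsum⟩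

end Summit.HodgeConjecture.HodgeConjecture.Cruxes.HLiu418.K2LiuKFiniteSectionMultiPlaceDegPS

end
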